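import Summits.Ventures.PercRepro.RankDistTightBiIndep

/-!
# PercRepro — THE LUBELL WEIGHTS OF THE RANK LEVELS, I: the plateau sum, the coloop-ending weight `ω`, the
spanning-subset identity, and the plateau decomposition of `N_u` (p9, gen 20)

For a finite matroid `M` on `n` elements, the LUBELL WEIGHT of the rank level `u` is
`W_u = Σ_{A ⊆ E, ρ(A) = u} 1 / C(n, |A|)` — the expected number of rank-`u` sets on a uniformly random maximal chain
`∅ ⊂ A₁ ⊂ … ⊂ E`; in integers `N_u = n!·W_u = Σ_{ρ(A) = u} |A|!·(n − |A|)!` (`lubellN`). This module proves the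
STATIC form of the chain argument of proofs/P9-S4-UPSET-g20.md §6:
* `plateauSum_mul`: `(b + 1)·Σ_{j ≤ a} C(a, j)·j!·(a + b − j)! = (a + b + 1)!` (hockey stick);
* `sum_omegaW_spanning`: `Σ_{S ⊆ A, ρ(S) = ρ(A)} ω(S)·(|A| − |S|)! = |A|!` with `ω(S) = c(S)·(|S| − 1)!`
  (`c(S)` = coloops of `M|S`; `ω(∅) = 1`) — every ordering of `A` has a unique hitting prefix `S` (the spanning
  subset at which the rank of `A` is first attained, ordered to end in a coloop), by induction on `|A|`;
* `lubellN_eq_sum_omegaW`: `N_u = Σ_{ρ(S) = u} ω(S)·Ψ(S)` with `Ψ(S) = Σ_{Y ⊆ cl(S) ∖ S} |Y|!·(n − |S| − |Y|)!`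
  (`plateauW`; the rank-`u` supersets of `S` are the `S ∪ Y`, `Y ⊆ cl(S) ∖ S`, `filter_superset_eq_image`).
The monotonicity `W_u ≤ W_{u+1}` is in `RankDistLubellMono`. Nothing here moves any window of the crux.
-/

namespace PercRepro.RankDist

open Set Finset _root_.Matroid PercRepro.ThmH

/-! ## The plateau sum `Φ(a, b) = Σ_j C(a,j)·j!·(a+b−j)! = (a+b+1)!/(b+1)` -/

/-- `Φ(a, b) = Σ_{j ≤ a} C(a, j)·j!·(a + b − j)!`: the total weight of the subsets `Y` of an `a`-set, each weighted
by `|Y|!·(a + b − |Y|)!`. -/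
def plateauSum (a b : ℕ) : ℕ := ∑ j ∈ Finset.range (a + 1), a.choose j * j.factorial * (a + b - j).factorial

/-- Termwise: `C(a, j)·j!·(a + b − j)! = a!·b!·C(a + b − j, b)` for `j ≤ a`. -/
lemma choose_mul_factorial_mul_factorial_eq {a b j : ℕ} (hj : j ≤ a) :
    a.choose j * j.factorial * (a + b - j).factorial = a.factorial * b.factorial * (a + b - j).choose b := by
  have h1 : a.choose j * j.factorial * (a - j).factorial = a.factorial := Nat.choose_mul_factorial_mul_factorial hj
  have h2 : (a + b - j).choose b * b.factorial * (a + b - j - b).factorial = (a + b - j).factorial :=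
    Nat.choose_mul_factorial_mul_factorial (by omega)
  have h3 : a + b - j - b = a - j := by omega
  rw [h3] at h2
  have hpos : 0 < (a - j).factorial := Nat.factorial_pos _
  apply Nat.eq_of_mul_eq_mul_right hpos
  calc a.choose j * j.factorial * (a + b - j).factorial * (a - j).factorial
      = (a.choose j * j.factorial * (a - j).factorial) * (a + b - j).factorial := by ring
    _ = a.factorial * ((a + b - j).choose b * b.factorial * (a - j).factorial) := by rw [h1, h2]
    _ = a.factorial * b.factorial * (a + b - j).choose b * (a - j).factorial := by ring

/-- **The closed form** `(b + 1)·Φ(a, b) = (a + b + 1)!` (hockey stick). -/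
theorem plateauSum_mul (a b : ℕ) : (b + 1) * plateauSum a b = (a + b + 1).factorial := by
  unfold plateauSum
  rw [Finset.sum_congr rfl (fun j hj => choose_mul_factorial_mul_factorial_eq (b := b)
    (Nat.lt_succ_iff.1 (Finset.mem_range.1 hj)))]
  rw [← Finset.mul_sum]
  -- reflect the index: `j ↦ a − j` turns `C(a + b − j, b)` into `C(j + b, b)`
  have hrefl : ∑ j ∈ Finset.range (a + 1), (a + b - j).choose b = ∑ j ∈ Finset.range (a + 1), (j + b).choose b := by
    rw [← Finset.sum_range_reflect (fun j => (j + b).choose b) (a + 1)]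
    refine Finset.sum_congr rfl fun j hj => ?_
    rw [Finset.mem_range] at hj
    congr 1
    omega
  rw [hrefl, Nat.sum_range_add_choose]
  have h := Nat.choose_mul_factorial_mul_factorial (n := a + b + 1) (k := b + 1) (by omega)
  have h' : a + b + 1 - (b + 1) = a := by omega
  rw [h'] at h
  calc (b + 1) * (a.factorial * b.factorial * (a + b + 1).choose (b + 1))
      = (a + b + 1).choose (b + 1) * ((b + 1) * b.factorial) * a.factorial := by ring
    _ = (a + b + 1).choose (b + 1) * (b + 1).factorial * a.factorial := by rw [Nat.factorial_succ]
    _ = (a + b + 1).factorial := h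

/-! ## The spanning subsets of a finset and the coloop-ending weight `ω` -/

variable {α : Type} [DecidableEq α] (M : Matroid α) [M.Finite]

/-- The coloops of `M|S`: the elements whose removal lowers the rank of `S`. -/
noncomputable def coloopsOf (S : Finset α) : Finset α :=
  S.filter (fun a => rk M ((S.erase a : Finset α) : Set α) < rk M (S : Set α))

/-- `ω(S)`: the number of orderings of `S` ending in a coloop of `M|S` — `c(S)·(|S| − 1)!`, and `1` for `S = ∅`. -/
noncomputable def omegaW (S : Finset α) : ℕ :=
  if S = ∅ then 1 else (coloopsOf M S).card * (S.card - 1).factorial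

/-- The spanning subsets of `A`: the `S ⊆ A` with `ρ(S) = ρ(A)`. -/
noncomputable def spanningSubsets (A : Finset α) : Finset (Finset α) :=
  A.powerset.filter (fun S => rk M (S : Set α) = rk M (A : Set α))

omit [DecidableEq α] [M.Finite] in
/-- Membership in `spanningSubsets`. -/
lemma mem_spanningSubsets {A S : Finset α} :
    S ∈ spanningSubsets M A ↔ S ⊆ A ∧ rk M (S : Set α) = rk M (A : Set α) := by
  unfold spanningSubsets
  rw [Finset.mem_filter, Finset.mem_powerset]

omit [DecidableEq α] in
/-- `rk` is monotone on subsets of `E`. -/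
lemma rk_mono_of_subset {S T : Set α} (hST : S ⊆ T) (hT : T ⊆ M.E) : rk M S ≤ rk M T := by
  have h := M.eRk_mono hST
  rw [eRk_eq_coe_rk M (hST.trans hT), eRk_eq_coe_rk M hT] at h
  exact_mod_cast h

/-- An element of `A` outside a spanning subset of `A` is not a coloop of `M|A`. -/
lemma notMem_coloopsOf_of_mem_spanning {A S : Finset α} (hA : (A : Set α) ⊆ M.E) (hS : S ∈ spanningSubsets M A)
    {a : α} (haS : a ∉ S) : a ∉ coloopsOf M A := by
  rw [mem_spanningSubsets] at hS
  unfold coloopsOf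
  rw [Finset.mem_filter, not_and]
  intro _
  rw [not_lt, ← hS.2]
  refine rk_mono_of_subset M ?_ ((Finset.coe_subset.2 (Finset.erase_subset a A)).trans hA)
  rw [Finset.coe_subset]
  intro x hx
  rw [Finset.mem_erase]
  exact ⟨fun h => haS (h ▸ hx), hS.1 hx⟩

/-- For a non-coloop `a` of `A`, the spanning subsets of `A ∖ a` are the spanning subsets of `A` avoiding `a`. -/
lemma spanningSubsets_erase {A : Finset α} (hA : (A : Set α) ⊆ M.E) {a : α} (haA : a ∈ A)
    (ha : a ∉ coloopsOf M A) :
    spanningSubsets M (A.erase a) = (spanningSubsets M A).filter (fun S => a ∉ S) := by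
  have hrk : rk M ((A.erase a : Finset α) : Set α) = rk M (A : Set α) := by
    unfold coloopsOf at ha
    rw [Finset.mem_filter, not_and, not_lt] at ha
    refine le_antisymm ?_ (ha haA)
    exact rk_mono_of_subset M (Finset.coe_subset.2 (Finset.erase_subset a A)) hA
  ext S
  rw [mem_spanningSubsets, Finset.mem_filter, mem_spanningSubsets, hrk]
  constructor
  · rintro ⟨hSA, hS⟩
    exact ⟨⟨(Finset.subset_erase.1 hSA).1, hS⟩, (Finset.subset_erase.1 hSA).2⟩
  · rintro ⟨⟨hSA, hS⟩, haS⟩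
    exact ⟨Finset.subset_erase.2 ⟨hSA, haS⟩, hS⟩

omit [M.Finite] in
/-- The coloops of `M|A` form a subset of `A`. -/
lemma coloopsOf_subset (A : Finset α) : coloopsOf M A ⊆ A := Finset.filter_subset _ _

/-- For a spanning subset `S` of `A`, the non-coloops of `A` outside `S` are exactly `A ∖ S`. -/
lemma filter_notMem_eq_sdiff {A S : Finset α} (hA : (A : Set α) ⊆ M.E) (hS : S ∈ spanningSubsets M A) :
    (A \ coloopsOf M A).filter (fun a => a ∉ S) = A \ S := by
  ext x
  simp only [Finset.mem_filter, Finset.mem_sdiff]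
  constructor
  · rintro ⟨⟨hxA, -⟩, hxS⟩; exact ⟨hxA, hxS⟩
  · rintro ⟨hxA, hxS⟩; exact ⟨⟨hxA, notMem_coloopsOf_of_mem_spanning M hA hS hxS⟩, hxS⟩

omit [DecidableEq α] [M.Finite] in
/-- `A` is a spanning subset of itself. -/
lemma self_mem_spanningSubsets (A : Finset α) : A ∈ spanningSubsets M A :=
  (mem_spanningSubsets M).2 ⟨subset_rfl, rfl⟩

/-- **THE SPANNING-SUBSET IDENTITY**: `Σ_{S ⊆ A, ρ(S) = ρ(A)} ω(S)·(|A| − |S|)! = |A|!` — every ordering of `A` has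
a unique hitting prefix `S` (the spanning subset at which the rank of `A` is first attained, ordered to end in a
coloop of `M|S`), followed by an ordering of `A ∖ S`. -/
theorem sum_omegaW_spanning (A : Finset α) (hA : (A : Set α) ⊆ M.E) :
    ∑ S ∈ spanningSubsets M A, omegaW M S * (A.card - S.card).factorial = A.card.factorial := by
  induction A using Finset.strongInduction with
  | H A ih =>
  rcases Finset.eq_empty_or_nonempty A with rfl | hne
  · have h0 : spanningSubsets M ∅ = {∅} := by
      ext S
      rw [mem_spanningSubsets, Finset.mem_singleton, Finset.subset_empty]
      constructor
      · rintro ⟨rfl, -⟩; rfl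
      · rintro rfl; exact ⟨rfl, rfl⟩
    rw [h0, Finset.sum_singleton, omegaW, if_pos rfl]
    simp
  have hAne : A ≠ ∅ := hne.ne_empty
  set col := coloopsOf M A with hcol
  -- `|A|! = Σ_{a ∈ A} (|A| − 1)!`, split over coloops and non-coloops
  have hsplit : A.card.factorial = ∑ a ∈ col, (A.card - 1).factorial + ∑ a ∈ A \ col, (A.card - 1).factorial := by
    rw [Finset.sum_const, Finset.sum_const, smul_eq_mul, smul_eq_mul, ← add_mul,
      Finset.card_sdiff_of_subset (coloopsOf_subset M A), Nat.add_sub_cancel' (Finset.card_le_card (coloopsOf_subset M A))]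
    rw [Nat.mul_factorial_pred (Finset.card_ne_zero.2 hne)]
  -- the coloop part is `ω(A)`
  have hcolpart : ∑ a ∈ col, (A.card - 1).factorial = omegaW M A := by
    rw [Finset.sum_const, smul_eq_mul, omegaW, if_neg hAne]
  -- the non-coloop part by the induction hypothesis on `A ∖ a`
  have hnon : ∑ a ∈ A \ col, (A.card - 1).factorial
      = ∑ S ∈ spanningSubsets M A, omegaW M S * (A.card - 1 - S.card).factorial * (A.card - S.card) := by
    have h1 : ∀ a ∈ A \ col, (A.card - 1).factorial
        = ∑ S ∈ (spanningSubsets M A).filter (fun S => a ∉ S), omegaW M S * (A.card - 1 - S.card).factorial := by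
      intro a ha
      rw [Finset.mem_sdiff] at ha
      have hsub : A.erase a ⊂ A := Finset.erase_ssubset ha.1
      have hih := ih (A.erase a) hsub ((Finset.coe_subset.2 (Finset.erase_subset a A)).trans hA)
      rw [Finset.card_erase_of_mem ha.1, spanningSubsets_erase M hA ha.1 ha.2] at hih
      exact hih.symm
    rw [Finset.sum_congr rfl h1]
    simp_rw [Finset.sum_filter]
    rw [Finset.sum_comm]
    refine Finset.sum_congr rfl fun S hS => ?_
    rw [← Finset.sum_filter, Finset.sum_const, smul_eq_mul, filter_notMem_eq_sdiff M hA hS,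
      Finset.card_sdiff_of_subset ((mem_spanningSubsets M).1 hS).1, mul_comm]
  -- `(|A| − 1 − |S|)!·(|A| − |S|) = (|A| − |S|)!` off `S = A`, and `0` at `S = A`
  have hterm : ∑ S ∈ spanningSubsets M A, omegaW M S * (A.card - 1 - S.card).factorial * (A.card - S.card)
      = ∑ S ∈ (spanningSubsets M A).erase A, omegaW M S * (A.card - S.card).factorial := by
    rw [← Finset.sum_erase (s := spanningSubsets M A) (a := A) (f := fun S =>
      omegaW M S * (A.card - 1 - S.card).factorial * (A.card - S.card)) (by simp)]
    refine Finset.sum_congr rfl fun S hS => ?_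
    rw [Finset.mem_erase] at hS
    have hSA := ((mem_spanningSubsets M).1 hS.2).1
    have hlt : S.card < A.card := Finset.card_lt_card (Finset.ssubset_iff_subset_ne.2 ⟨hSA, hS.1⟩)
    have h2 : A.card - 1 - S.card = A.card - S.card - 1 := by omega
    rw [h2, mul_assoc, mul_comm ((A.card - S.card - 1).factorial), Nat.mul_factorial_pred (by omega)]
  rw [hsplit, hcolpart, hnon, hterm, ← Finset.sum_erase_add _ _ (self_mem_spanningSubsets M A),
    Nat.sub_self, Nat.factorial_zero, mul_one, add_comm]

/-! ## The closure finset, the plateau weight `Ψ`, and the Lubell count `N_u` -/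

open scoped Classical in
/-- The closure of `S` as a finset: the elements of `E` in `cl(S)`. -/
noncomputable def clF (S : Finset α) : Finset α := (gr M).filter (fun e => e ∈ M.closure (S : Set α))

open scoped Classical in
omit [DecidableEq α] in
/-- Membership in `clF`. -/
lemma mem_clF {S : Finset α} {e : α} : e ∈ clF M S ↔ e ∈ M.closure (S : Set α) := by
  unfold clF
  rw [Finset.mem_filter]
  refine ⟨fun h => h.2, fun h => ⟨?_, h⟩⟩
  rw [← Finset.mem_coe, coe_gr]
  exact M.closure_subset_ground _ h

open scoped Classical in
omit [DecidableEq α] in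
/-- `cl(S) ⊆ E`. -/
lemma clF_subset_gr (S : Finset α) : clF M S ⊆ gr M := Finset.filter_subset _ _

omit [DecidableEq α] in
/-- `S ⊆ cl(S)` for `S ⊆ E`. -/
lemma subset_clF {S : Finset α} (hS : (S : Set α) ⊆ M.E) : S ⊆ clF M S := by
  intro e he
  rw [mem_clF]
  exact M.subset_closure _ hS (Finset.mem_coe.2 he)

omit [DecidableEq α] in
/-- `cl` is monotone. -/
lemma clF_mono {S T : Finset α} (hST : S ⊆ T) : clF M S ⊆ clF M T := by
  intro e he
  rw [mem_clF] at he ⊢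
  exact M.closure_subset_closure (Finset.coe_subset.2 hST) he

omit [DecidableEq α] in
/-- For `S ⊆ A ⊆ E`: `ρ(A) = ρ(S)` iff `A ⊆ cl(S)`. -/
lemma rk_eq_iff_subset_clF {S A : Finset α} (hSA : S ⊆ A) (hA : (A : Set α) ⊆ M.E) :
    rk M (A : Set α) = rk M (S : Set α) ↔ A ⊆ clF M S := by
  have hS : (S : Set α) ⊆ M.E := (Finset.coe_subset.2 hSA).trans hA
  constructor
  · intro h
    have hfin : M.IsRkFinite (S : Set α) := RankFinite.isRkFinite _
    have hle : M.eRk (A : Set α) ≤ M.eRk (S : Set α) := by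
      rw [eRk_eq_coe_rk M hA, eRk_eq_coe_rk M hS, h]
    have hcl := hfin.closure_eq_closure_of_subset_of_eRk_ge_eRk (Finset.coe_subset.2 hSA) hle
    intro e he
    rw [mem_clF, hcl]
    exact M.subset_closure _ hA (Finset.mem_coe.2 he)
  · intro h
    refine le_antisymm ?_ (rk_mono_of_subset M (Finset.coe_subset.2 hSA) hA)
    have h1 : M.eRk (A : Set α) ≤ M.eRk (M.closure (S : Set α)) := by
      refine M.eRk_mono fun e he => ?_
      exact (mem_clF M).1 (h (Finset.mem_coe.1 he))
    rw [M.eRk_closure_eq, eRk_eq_coe_rk M hA, eRk_eq_coe_rk M hS] at h1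
    exact_mod_cast h1

/-- `Ψ(S) = Σ_{Y ⊆ cl(S) ∖ S} |Y|!·(n − |S| − |Y|)!`: the total weight of the rank-`ρ(S)` supersets of `S`. -/
noncomputable def plateauW (S : Finset α) : ℕ :=
  ∑ Y ∈ (clF M S \ S).powerset, Y.card.factorial * ((gr M).card - S.card - Y.card).factorial

/-- The rank-`u` subsets of `E`. -/
noncomputable def rankLevelFin (u : ℕ) : Finset (Finset α) :=
  (gr M).powerset.filter (fun A => rk M (A : Set α) = u)

omit [DecidableEq α] in
/-- Membership in `rankLevelFin`. -/
lemma mem_rankLevelFin {u : ℕ} {A : Finset α} :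
    A ∈ rankLevelFin M u ↔ A ⊆ gr M ∧ rk M (A : Set α) = u := by
  unfold rankLevelFin
  rw [Finset.mem_filter, Finset.mem_powerset]

/-- `N_u = Σ_{A ⊆ E, ρ(A) = u} |A|!·(n − |A|)!` — `n!` times the Lubell weight of the rank level `u`. -/
noncomputable def lubellN (u : ℕ) : ℕ :=
  ∑ A ∈ rankLevelFin M u, A.card.factorial * ((gr M).card - A.card).factorial

omit [DecidableEq α] in
/-- `A ⊆ gr M` as finsets iff `↑A ⊆ M.E`. -/
lemma subset_gr_iff {A : Finset α} : A ⊆ gr M ↔ (A : Set α) ⊆ M.E := by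
  rw [← Finset.coe_subset, coe_gr]

/-- The rank-`u` supersets of a rank-`u` set `S` are the sets `S ∪ Y`, `Y ⊆ cl(S) ∖ S`. -/
lemma filter_superset_eq_image {u : ℕ} {S : Finset α} (hS : S ∈ rankLevelFin M u) :
    (rankLevelFin M u).filter (fun A => S ⊆ A) = (clF M S \ S).powerset.image (fun Y => S ∪ Y) := by
  obtain ⟨hSE, hSu⟩ := (mem_rankLevelFin M).1 hS
  have hSE' : (S : Set α) ⊆ M.E := (subset_gr_iff M).1 hSE
  ext A
  rw [Finset.mem_filter, mem_rankLevelFin, Finset.mem_image]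
  constructor
  · rintro ⟨⟨hAE, hAu⟩, hSA⟩
    refine ⟨A \ S, ?_, by rw [Finset.union_sdiff_of_subset hSA]⟩
    rw [Finset.mem_powerset]
    have hAcl : A ⊆ clF M S := (rk_eq_iff_subset_clF M hSA ((subset_gr_iff M).1 hAE)).1 (by rw [hAu, hSu])
    exact Finset.sdiff_subset_sdiff hAcl subset_rfl
  · rintro ⟨Y, hY, rfl⟩
    rw [Finset.mem_powerset] at hY
    have hYcl : Y ⊆ clF M S := hY.trans Finset.sdiff_subset
    have hAE : S ∪ Y ⊆ gr M := Finset.union_subset hSE (hYcl.trans (clF_subset_gr M S))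
    refine ⟨⟨hAE, ?_⟩, Finset.subset_union_left⟩
    rw [← hSu]
    exact (rk_eq_iff_subset_clF M Finset.subset_union_left ((subset_gr_iff M).1 hAE)).2
      (Finset.union_subset (subset_clF M hSE') hYcl)

/-- **The plateau decomposition of `N_u`**: `N_u = Σ_{S : ρ(S) = u} ω(S)·Ψ(S)`. -/
theorem lubellN_eq_sum_omegaW (u : ℕ) :
    lubellN M u = ∑ S ∈ rankLevelFin M u, omegaW M S * plateauW M S := by
  unfold lubellN
  -- expand each `|A|!` by the spanning-subset identity
  have h1 : ∀ A ∈ rankLevelFin M u, A.card.factorial * ((gr M).card - A.card).factorial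
      = ∑ S ∈ spanningSubsets M A, omegaW M S * ((A.card - S.card).factorial * ((gr M).card - A.card).factorial) := by
    intro A hA
    rw [← sum_omegaW_spanning M A ((subset_gr_iff M).1 ((mem_rankLevelFin M).1 hA).1), Finset.sum_mul]
    exact Finset.sum_congr rfl fun S _ => by ring
  rw [Finset.sum_congr rfl h1]
  -- swap the sums: pairs `(A, S)` with `S` spanning in `A` ↔ `(S, A)` with `A` a rank-`u` superset of `S`
  rw [Finset.sum_comm' (t' := rankLevelFin M u) (s' := fun S => (rankLevelFin M u).filter (fun A => S ⊆ A))]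
  · refine Finset.sum_congr rfl fun S hS => ?_
    rw [← Finset.mul_sum, filter_superset_eq_image M hS, Finset.sum_image]
    · unfold plateauW
      congr 1
      refine Finset.sum_congr rfl fun Y hY => ?_
      rw [Finset.mem_powerset] at hY
      have hdisj : Disjoint S Y := Finset.disjoint_of_subset_right hY Finset.disjoint_sdiff
      rw [Finset.card_union_of_disjoint hdisj, Nat.add_sub_cancel_left, Nat.sub_sub]
    · intro Y₁ hY₁ Y₂ hY₂ h
      rw [Finset.mem_coe, Finset.mem_powerset] at hY₁ hY₂
      have e1 : (S ∪ Y₁) \ S = Y₁ := Finset.union_sdiff_cancel_left (Finset.disjoint_of_subset_right hY₁ Finset.disjoint_sdiff)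
      have e2 : (S ∪ Y₂) \ S = Y₂ := Finset.union_sdiff_cancel_left (Finset.disjoint_of_subset_right hY₂ Finset.disjoint_sdiff)
      simp only at h
      rw [← e1, ← e2, h]
  · intro A S
    simp only [mem_rankLevelFin, mem_spanningSubsets, Finset.mem_filter]
    constructor
    · rintro ⟨⟨hAE, hAu⟩, hSA, hrk⟩
      exact ⟨⟨⟨hAE, hAu⟩, hSA⟩, hSA.trans hAE, by rw [hrk, hAu]⟩
    · rintro ⟨⟨⟨hAE, hAu⟩, hSA⟩, -, hSu⟩
      exact ⟨⟨hAE, hAu⟩, hSA, by rw [hSu, hAu]⟩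

end PercRepro.RankDist
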